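import Summits.QuantumFields.YangMills.Theorems.BalabanUVNodesN19AtSpineCarriers

/-!
# YM-DAG node N19 (= NE7 proper) — THE MATCHING PSEUDO-METRIC: `Spine.NE7.Core` modulo constants read INTRINSICALLY
# (chain rule across intermediate cores, run symmetry, invariance under constants and common factors, the ∃c-FREE oscillation
# form), N19's ∃δ-edge as «summably bounded oscillation», its faces at the spine carriers, and the Z-level twin of the DECL target

Cell `pub-ymgap`, HUMAN RULING D-0062 (Track A), R141 (C) wider-strategy seat `pub-ymgap-dag-n19-e` (strategy s3 = ALTERNATIVE CURRENCY), second
module of the seat (the first, `…Theorems.BalabanUVNodesN19BudgetRoad` p453434, REDUCED Σδ_K to «weights summable + margin window» with `Core` AT THE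
BUDGET displayed).  Route `Summits/QuantumFields/YangMills/Theses/BalabanUVNodes.lean`, cluster item K3 «SpineGivenEndpointR11» (stmt-QuantumFields-19676);
filed `--supports` that item.  COUNT-NEUTRAL: elementary real analysis + bookkeeping by name; NOT a discharge claim.

THE OBJECT.  NE7 proper is the `core` field of `T4MatchingAssembly.HybridNE7`, named `Spine.NE7.Core l₀ vol T Bad P Q δ` (`Spine/NE7/Targets.lean` :71):
for every `K` ONE constant `c_K`, independent of the source strength `t` and of the class, with `e^{c_K − vol·δ_K}·P ≤ Q ≤ e^{c_K + vol·δ_K}·P` on every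
good class `τ ∈ T K ∖ Bad K t`, `|t| ≤ l₀` (`P = A − shA`, `Q = B − shB` the two runs' shell-free cores).  N19's sentence at the spine carriers is the
∃δ-EDGE `∃ δ, Core … δ ∧ Summable δ` (`N19AtSpineCarriers.s_N19_of_coreEdge` :146; `YMDAG.UVSplit.S_N19` under the `deltaOfRecord` pin :74) and its DECL
target is `Spine.NE7.Target vol l₀ δ′ Z := MatchingModConstants vol l₀ δ′ Z ∧ Summable δ′` (`Targets.lean` :63).  Both carry TWO existentials over functions
of Bałaban's objects — matching constants `c_K` and a remainder `δ` — which every producer so far EXHIBITS (the H1L face `core_of_pathLeaf` builds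
`c_K = φ_K(1) − φ_K(0)`; the knits build `δ` from rate letters).  Here both are removed: `Core` modulo constants is a PSEUDO-METRIC on families of term
cores whose level-`K` distance is half the OSCILLATION of `log Q_K − log P_K` over the good points `(t, τ)`, and N19's edge says «that oscillation is
summably bounded» — the node's alternative currency, with the composition law a multi-leg route needs.

WHAT IS KERNEL-CHECKED ([folklore] = elementary real analysis; [bookkeeping] = tree theorems BY NAME; 0 `def`, 0 `sorry`).
* §1 THE PSEUDO-METRIC.  `core_self_zero` · `core_symm` (runs swap, `c ↦ −c`; no sign condition) · `core_trans` — THE CHAIN RULE `Core P M δ₁ →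
  Core M Q δ₂ → Core P Q (δ₁+δ₂)`, `c = c₁ + c₂`: matching COMPOSES across an intermediate core family `M` (the H1L route of `Targets.lean` §3 runs its
  path from «run A⁺'s core», a re-blocked run A, to run B's; whenever `A⁺ ≠ A` the leg `A → A⁺` must itself be a `Core`, and this law joins the legs) ·
  `core_trans_union` (legs with different bad classes compose on their union) · `core_congr` ∕ `core_of_subset` (only values at good points matter;
  fewer good points is weaker) · `core_vol_one_iff` (the volume factor is absorbed into `δ`) · `core_const_mul_self` ∕ `core_const_mul_right(_iff)` ∕
  `core_const_mul_left_iff` — «MODULO CONSTANTS» MADE LITERAL: a `(t,τ)`-INDEPENDENT factor `κ_K > 0` on either run is invisible (`c ↦ c ± log κ_K`;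
  differing field-independent counterterms of the two runs drop out) · `core_common_mul_iff` — a COMMON positive `(t,τ)`-dependent factor cancels.
* §2 THE INTRINSIC FORM.  `exists_center_of_pairwise_le` (reals pairwise within `2η` have a centre within `η`: midpoint of `[sInf, sSup]`) ·
  `abs_log_sub_log_sub_le_of_sandwich` (converse of `NE7.sandwich_of_abs_log_sub_le` :134) · `logRatio_sub_logRatio_le_of_core` (NECESSITY: under
  `Core`, at two good points of level `K` with positive run-A cores, `(log Q − log P)(t,τ) − (log Q − log P)(t′,τ′) ≤ 2·vol·δ_K` — the disprover's
  handle) · `core_of_logRatio_osc_le` (SUFFICIENCY: positive cores with that oscillation bound satisfy `Core`, `sandwich_of_abs_log_sub_le` BY NAME) ·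
  `core_iff_logRatio_osc_le` · `coreEdge_iff_summable_osc` (`0 < vol`: `(∃ δ, Core … δ ∧ Summable δ) ↔ ∃ D, Summable D ∧` «pairwise oscillation at level
  K ≤ D K» — NO constants, NO remainder to exhibit; the harmonic toy of `…N19BudgetRoad` :284 is the instance «oscillation `2∕(K+1)`») ·
  `coreEdge_trans` (two summable legs compose to the edge).
* §3 AT THE SPINE CARRIERS [bookkeeping] (`s_N19_of_coreEdge` BY NAME; `SRec`, `Inputs` PARAMETERS): `s_N19_of_oscillationReading` (a reading handing
  `0 < S.vol`, positive shell-free cores on good classes and a summable oscillation bound ⇒ `S_N19 SRec Inputs`) · `s_N19_of_twoLegReading` (a reading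
  handing an intermediate core family with two summable legs ⇒ `S_N19`).  READINGS for producers; nothing is produced here.
* §4 THE Z-LEVEL TWIN (currency of `T4CauchySum` :99 ∕ :104).  `matchingModConstants_of_genFun_increments` (uniform bound `|genFun Z (K+1) t −
  genFun Z K t| ≤ vol·δ_K` ⇒ `MatchingModConstants vol l₀ δ Z` with the CANONICAL constants `c_K := log Z_{K+1}(0) − log Z_K(0)`; converse
  `T4CauchySum.abs_genFun_succ_sub_le` :301, factor 2) · `exists_target_iff_summable_genFun_increments` (`0 ≤ l₀`: `(∃ vol δ, Target vol l₀ δ Z) ↔`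
  «uniformly absolutely summable increments of the generating functions» — a statement about `Z` alone) · `exists_tendsto_genFun_not_target` —
  KERNEL GUARD: a positive `Z` whose generating functions CONVERGE for every `t` and which matches step-wise modulo constants with VANISHING remainder
  (`MatchingModConstants 1 1 δ₀ Z`, `δ₀ → 0`), yet `¬ ∃ vol δ, Target vol 1 δ Z` (`T4ApexVariance.exists_tendsto_not_summable_increments` :686 lifted
  to `Z_K(t) = e^{t·a_K}`).  With `…N19BudgetRoad` §3 (step-wise matching, δ_K → 0, NOT Cauchy :326): node U0 consumes «Cauchy generating functions»
  (`cauchySeq_genFun` :319); N19's `Target` is the SUFFICIENT road the spine chose, strictly stronger than U0's input — a failure of `Σ_K δ_K < ∞`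
  AS TYPED would refute this road, not by itself the T⁴ continuum limit (located remark for the referee).

HONEST FRAMING.  NE7 ∕ NE7b ∕ NE7c are NOT PRINTED ([Balaban1987RG1]–[Balaban1989LargeFieldII] bound ONE run uniformly in `ε`; printed template
[King1986] (3.10)–(3.13) pp. 656–657, context only) and NOT PROVED; `Core`, `Target`, `SRec`, `Inputs` occur as hypotheses ∕ parameters only; §2's
sets and §4's `Z` are abstract reals; nothing of Bałaban's is asserted or instantiated; N19 is NOT discharged; Track A count unmoved (5∕27).  One
finite four-torus at fixed ε, rung (B)+1 — NOT infinite volume, NOT OS on ℝ⁴, NOT a mass gap, NOT Clay.  THEOREMS ONLY; 0 sorry; standard axioms.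
-/

set_option autoImplicit false

noncomputable section

open Finset Filter Topology
open scoped BigOperators

namespace Summit.QuantumFields.YangMills.BalabanUVNodes.N19CoreMetric

open Literature.MathematicalPhysics.QuantumFieldTheory.Balaban1983to89
open T4CauchySum (MatchingModConstants genFun)
open Summit.QuantumFields.BalabanUV.T4Continuum.Spine
open Summit.QuantumFields.YangMills.BalabanUVNodes.N19AtSpineCarriers (deltaOfRecord s_N19_of_coreEdge)
open YMDAG.UVSplit (SpineCarriers SpineRecordPred InputsPred S_N19)

/-! ## §1 `Core` modulo constants is a pseudo-metric on families of term cores [folklore] -/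

section Metric

variable {ι : Type*} [DecidableEq ι] {l₀ vol : ℝ} {T : ℕ → Finset ι} {Bad : ℕ → ℝ → Finset ι}
  {P Q R : ℕ → ℝ → ι → ℝ} {δ δ₁ δ₂ : ℕ → ℝ} {κ : ℕ → ℝ}

/-- REFLEXIVITY: every core family matches itself with constant `0` and remainder `0`. [folklore] -/
theorem core_self_zero : NE7.Core l₀ vol T Bad P P (fun _ => 0) := fun K =>
  ⟨0, fun t _ τ _ => by simp⟩

/-- SYMMETRY: the runs swap with the same remainder (`c ↦ −c`); no sign condition on the cores is needed. [folklore] -/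
theorem core_symm (h : NE7.Core l₀ vol T Bad P Q δ) : NE7.Core l₀ vol T Bad Q P δ := by
  intro K
  obtain ⟨c, hc⟩ := h K
  refine ⟨-c, fun t ht τ hτ => ?_⟩
  obtain ⟨hlo, hhi⟩ := hc t ht τ hτ
  constructor
  · calc Real.exp (-c - vol * δ K) * Q K t τ
        ≤ Real.exp (-c - vol * δ K) * (Real.exp (c + vol * δ K) * P K t τ) := mul_le_mul_of_nonneg_left hhi (Real.exp_pos _).le
      _ = P K t τ := by
          rw [← mul_assoc, ← Real.exp_add, show -c - vol * δ K + (c + vol * δ K) = 0 by ring, Real.exp_zero, one_mul]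
  · calc P K t τ = Real.exp (-c + vol * δ K) * (Real.exp (c - vol * δ K) * P K t τ) := by
          rw [← mul_assoc, ← Real.exp_add, show -c + vol * δ K + (c - vol * δ K) = 0 by ring, Real.exp_zero, one_mul]
      _ ≤ Real.exp (-c + vol * δ K) * Q K t τ := mul_le_mul_of_nonneg_left hlo (Real.exp_pos _).le

/-- **THE CHAIN RULE** (triangle inequality of the matching pseudo-metric): `Core P M δ₁` and `Core M Q δ₂` give `Core P Q (δ₁ + δ₂)` with
constants `c₁ + c₂` — matching COMPOSES across an intermediate core family `M` (a two-leg route A → A⁺ → B); no sign condition. [folklore] -/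
theorem core_trans {M : ℕ → ℝ → ι → ℝ} (h₁ : NE7.Core l₀ vol T Bad P M δ₁) (h₂ : NE7.Core l₀ vol T Bad M Q δ₂) :
    NE7.Core l₀ vol T Bad P Q (fun K => δ₁ K + δ₂ K) := by
  intro K
  obtain ⟨c₁, hc₁⟩ := h₁ K
  obtain ⟨c₂, hc₂⟩ := h₂ K
  refine ⟨c₁ + c₂, fun t ht τ hτ => ?_⟩
  obtain ⟨h1l, h1u⟩ := hc₁ t ht τ hτ
  obtain ⟨h2l, h2u⟩ := hc₂ t ht τ hτ
  constructor
  · calc Real.exp (c₁ + c₂ - vol * (δ₁ K + δ₂ K)) * P K t τ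
        = Real.exp (c₂ - vol * δ₂ K) * (Real.exp (c₁ - vol * δ₁ K) * P K t τ) := by
          rw [show c₁ + c₂ - vol * (δ₁ K + δ₂ K) = (c₂ - vol * δ₂ K) + (c₁ - vol * δ₁ K) by ring,
            Real.exp_add (c₂ - vol * δ₂ K) (c₁ - vol * δ₁ K), mul_assoc]
      _ ≤ Real.exp (c₂ - vol * δ₂ K) * M K t τ := mul_le_mul_of_nonneg_left h1l (Real.exp_pos _).le
      _ ≤ Q K t τ := h2l
  · calc Q K t τ ≤ Real.exp (c₂ + vol * δ₂ K) * M K t τ := h2u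
      _ ≤ Real.exp (c₂ + vol * δ₂ K) * (Real.exp (c₁ + vol * δ₁ K) * P K t τ) :=
          mul_le_mul_of_nonneg_left h1u (Real.exp_pos _).le
      _ = Real.exp (c₁ + c₂ + vol * (δ₁ K + δ₂ K)) * P K t τ := by
          rw [show c₁ + c₂ + vol * (δ₁ K + δ₂ K) = (c₂ + vol * δ₂ K) + (c₁ + vol * δ₁ K) by ring,
            Real.exp_add (c₂ + vol * δ₂ K) (c₁ + vol * δ₁ K), mul_assoc]

/-- Only the values AT GOOD POINTS matter: cores agreeing with `P`, `Q` on every good class inherit `Core`. [folklore] -/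
theorem core_congr {P' Q' : ℕ → ℝ → ι → ℝ} (hP : ∀ K t, |t| ≤ l₀ → ∀ τ ∈ T K \ Bad K t, P' K t τ = P K t τ)
    (hQ : ∀ K t, |t| ≤ l₀ → ∀ τ ∈ T K \ Bad K t, Q' K t τ = Q K t τ) (h : NE7.Core l₀ vol T Bad P Q δ) :
    NE7.Core l₀ vol T Bad P' Q' δ := by
  intro K
  obtain ⟨c, hc⟩ := h K
  refine ⟨c, fun t ht τ hτ => ?_⟩
  rw [hP K t ht τ hτ, hQ K t ht τ hτ]
  exact hc t ht τ hτ

/-- RESTRICTION: `Core` persists on fewer good points (a smaller radius `l₀′ ≤ l₀`, and at each `(K, t)` a set of good classes contained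
in the original one — more bad classes, fewer classes) with the same constants and remainder. [folklore] -/
theorem core_of_subset {l₀' : ℝ} {T' : ℕ → Finset ι} {Bad' : ℕ → ℝ → Finset ι} (hl : l₀' ≤ l₀)
    (hsub : ∀ K t, |t| ≤ l₀' → T' K \ Bad' K t ⊆ T K \ Bad K t) (h : NE7.Core l₀ vol T Bad P Q δ) :
    NE7.Core l₀' vol T' Bad' P Q δ := by
  intro K
  obtain ⟨c, hc⟩ := h K
  exact ⟨c, fun t ht τ hτ => hc t (ht.trans hl) τ (hsub K t ht hτ)⟩

/-- The chain rule for legs with DIFFERENT bad classes: they compose on the union of the bad classes. [folklore] -/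
theorem core_trans_union {M : ℕ → ℝ → ι → ℝ} {Bad₁ Bad₂ : ℕ → ℝ → Finset ι} (h₁ : NE7.Core l₀ vol T Bad₁ P M δ₁)
    (h₂ : NE7.Core l₀ vol T Bad₂ M Q δ₂) :
    NE7.Core l₀ vol T (fun K t => Bad₁ K t ∪ Bad₂ K t) P Q (fun K => δ₁ K + δ₂ K) := by
  have hs : ∀ (B B' : ℕ → ℝ → Finset ι), (∀ K t, B K t ⊆ B' K t) → ∀ K t, T K \ B' K t ⊆ T K \ B K t :=
    fun B B' hB K t => sdiff_subset_sdiff (Subset.refl _) (hB K t)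
  exact core_trans (core_of_subset le_rfl (fun K t _ => hs Bad₁ _ (fun K t => subset_union_left) K t) h₁)
    (core_of_subset le_rfl (fun K t _ => hs Bad₂ _ (fun K t => subset_union_right) K t) h₂)

/-- The volume factor is absorbed into the remainder: `Core l₀ vol … δ ↔ Core l₀ 1 … (K ↦ vol·δ_K)`. [folklore] -/
theorem core_vol_one_iff : NE7.Core l₀ vol T Bad P Q δ ↔ NE7.Core l₀ 1 T Bad P Q (fun K => vol * δ K) := by
  simp only [NE7.Core, one_mul]

/-- A `(t,τ)`-independent rescaling of a core family matches it EXACTLY (remainder `0`, constant `log κ_K`). [folklore] -/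
theorem core_const_mul_self (hκ : ∀ K, 0 < κ K) : NE7.Core l₀ vol T Bad Q (fun K t τ => κ K * Q K t τ) (fun _ => 0) := fun K =>
  ⟨Real.log (κ K), fun t _ τ _ => by simp [Real.exp_log (hκ K)]⟩

/-- **MODULO CONSTANTS, LITERALLY** (right run): multiplying run B's cores by any `(t,τ)`-INDEPENDENT factor `κ_K > 0` preserves `Core` with the
same remainder (`c ↦ c + log κ_K`; chain rule with `core_const_mul_self`). [folklore] -/
theorem core_const_mul_right (hκ : ∀ K, 0 < κ K) (h : NE7.Core l₀ vol T Bad P Q δ) :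
    NE7.Core l₀ vol T Bad P (fun K t τ => κ K * Q K t τ) δ := by
  simpa using core_trans h (core_const_mul_self hκ)

/-- … and conversely (undo with `κ_K⁻¹`): `Core P (κ·Q) δ ↔ Core P Q δ`. [folklore] -/
theorem core_const_mul_right_iff (hκ : ∀ K, 0 < κ K) :
    NE7.Core l₀ vol T Bad P (fun K t τ => κ K * Q K t τ) δ ↔ NE7.Core l₀ vol T Bad P Q δ := by
  refine ⟨fun h => ?_, core_const_mul_right hκ⟩
  have h' : NE7.Core l₀ vol T Bad P (fun K t τ => (κ K)⁻¹ * (κ K * Q K t τ)) δ :=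
    core_const_mul_right (fun K => inv_pos.mpr (hκ K)) h
  exact core_congr (fun _ _ _ _ _ => rfl) (fun K t _ τ _ => (inv_mul_cancel_left₀ (hκ K).ne' (Q K t τ)).symm) h'

/-- MODULO CONSTANTS, LITERALLY (left run): `Core (κ·P) Q δ ↔ Core P Q δ` for `κ_K > 0` (by symmetry). [folklore] -/
theorem core_const_mul_left_iff (hκ : ∀ K, 0 < κ K) :
    NE7.Core l₀ vol T Bad (fun K t τ => κ K * P K t τ) Q δ ↔ NE7.Core l₀ vol T Bad P Q δ :=
  ⟨fun h => core_symm ((core_const_mul_right_iff hκ).mp (core_symm h)),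
    fun h => core_symm ((core_const_mul_right_iff hκ).mpr (core_symm h))⟩

/-- **COMMON FACTORS CANCEL**: a positive `(t,τ)`-dependent factor `w` multiplying BOTH runs' cores on the good classes is invisible to
`Core` (same constants, same remainder) — e.g. the same characteristic functions or the same observable insertion on both sides. [folklore] -/
theorem core_common_mul_iff {w : ℕ → ℝ → ι → ℝ} (hw : ∀ K t, |t| ≤ l₀ → ∀ τ ∈ T K \ Bad K t, 0 < w K t τ) :
    NE7.Core l₀ vol T Bad (fun K t τ => w K t τ * P K t τ) (fun K t τ => w K t τ * Q K t τ) δ ↔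
      NE7.Core l₀ vol T Bad P Q δ := by
  refine forall_congr' fun K => exists_congr fun c => forall_congr' fun t => forall_congr' fun ht =>
    forall_congr' fun τ => forall_congr' fun hτ => ?_
  have hw0 := hw K t ht τ hτ
  rw [mul_left_comm (Real.exp (c - vol * δ K)) (w K t τ), mul_left_comm (Real.exp (c + vol * δ K)) (w K t τ),
    mul_le_mul_iff_of_pos_left hw0, mul_le_mul_iff_of_pos_left hw0]

end Metric

/-! ## §2 The intrinsic form: `Core` ⟺ the log-ratio of the cores has pairwise oscillation `≤ 2·vol·δ_K` [folklore] -/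

section Oscillation

variable {ι : Type*} [DecidableEq ι] {l₀ vol : ℝ} {T : ℕ → Finset ι} {Bad : ℕ → ℝ → Finset ι}
  {P Q : ℕ → ℝ → ι → ℝ} {δ : ℕ → ℝ}

/-- THE MIDPOINT LEMMA: a set of reals with points pairwise within `2η` (one-sided form `x ≤ y + 2η`) has a CENTRE `c`, `|x − c| ≤ η` for
all its points (`c` = midpoint of `[sInf s, sSup s]`; `0` if the set is empty). [folklore] -/
theorem exists_center_of_pairwise_le {s : Set ℝ} {η : ℝ} (h : ∀ x ∈ s, ∀ y ∈ s, x ≤ y + 2 * η) :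
    ∃ c : ℝ, ∀ x ∈ s, |x - c| ≤ η := by
  by_cases hne : s.Nonempty
  · obtain ⟨x₀, hx₀⟩ := hne
    have hab : BddAbove s := ⟨x₀ + 2 * η, fun x hx => h x hx x₀ hx₀⟩
    have hbb : BddBelow s := ⟨x₀ - 2 * η, fun x hx => by have := h x₀ hx₀ x hx; linarith⟩
    have hgap : sSup s ≤ sInf s + 2 * η :=
      csSup_le ⟨x₀, hx₀⟩ fun x hx => by
        have : x - 2 * η ≤ sInf s := le_csInf ⟨x₀, hx₀⟩ fun y hy => by have := h x hx y hy; linarith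
        linarith
    refine ⟨(sSup s + sInf s) / 2, fun x hx => ?_⟩
    have h1 := le_csSup hab hx
    have h2 := csInf_le hbb hx
    exact abs_le.mpr ⟨by linarith, by linarith⟩
  · exact ⟨0, fun x hx => (hne ⟨x, hx⟩).elim⟩

/-- The converse of `NE7.sandwich_of_abs_log_sub_le`: a two-sided multiplicative sandwich of a positive `P` pins the log-ratio,
`|log Q − log P − c| ≤ η` (and forces `0 < Q`). [folklore] -/
theorem abs_log_sub_log_sub_le_of_sandwich {P Q c η : ℝ} (hP : 0 < P) (hlo : Real.exp (c - η) * P ≤ Q)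
    (hhi : Q ≤ Real.exp (c + η) * P) : |Real.log Q - Real.log P - c| ≤ η := by
  have hQ : 0 < Q := (mul_pos (Real.exp_pos _) hP).trans_le hlo
  have h1 := Real.log_le_log (mul_pos (Real.exp_pos _) hP) hlo
  have h2 := Real.log_le_log hQ hhi
  rw [Real.log_mul (Real.exp_pos _).ne' hP.ne', Real.log_exp] at h1
  rw [Real.log_mul (Real.exp_pos _).ne' hP.ne', Real.log_exp] at h2
  exact abs_le.mpr ⟨by linarith, by linarith⟩

/-- **NECESSITY**: under `Core`, at any two good points `(t,τ)`, `(t′,τ′)` of level `K` (run A's cores positive there) the log-ratios differ by at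
most `2·vol·δ_K` — both lie in `[c_K − vol·δ_K, c_K + vol·δ_K]`.  The disprover's handle: two good points with a larger gap kill `Core` at `δ`
(the harmonic toy of `…N19BudgetRoad` §3 used `t = ±1`). [folklore] -/
theorem logRatio_sub_logRatio_le_of_core (h : NE7.Core l₀ vol T Bad P Q δ) (K : ℕ) {t t' : ℝ} (ht : |t| ≤ l₀) (ht' : |t'| ≤ l₀)
    {τ τ' : ι} (hτ : τ ∈ T K \ Bad K t) (hτ' : τ' ∈ T K \ Bad K t') (hP : 0 < P K t τ) (hP' : 0 < P K t' τ') :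
    (Real.log (Q K t τ) - Real.log (P K t τ)) - (Real.log (Q K t' τ') - Real.log (P K t' τ')) ≤ 2 * (vol * δ K) := by
  obtain ⟨c, hc⟩ := h K
  have h1 := abs_le.mp (abs_log_sub_log_sub_le_of_sandwich hP (hc t ht τ hτ).1 (hc t ht τ hτ).2)
  have h2 := abs_le.mp (abs_log_sub_log_sub_le_of_sandwich hP' (hc t' ht' τ' hτ').1 (hc t' ht' τ' hτ').2)
  linarith [h1.2, h2.1]

/-- **SUFFICIENCY**: positive cores whose log-ratio has, at every level `K`, pairwise oscillation `≤ 2·vol·δ_K` over the good points satisfy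
`Core … δ` — `c_K` := the centre of the level-`K` log-ratios (midpoint lemma), then `NE7.sandwich_of_abs_log_sub_le` BY NAME. [folklore] -/
theorem core_of_logRatio_osc_le (hP : ∀ K t, |t| ≤ l₀ → ∀ τ ∈ T K \ Bad K t, 0 < P K t τ)
    (hQ : ∀ K t, |t| ≤ l₀ → ∀ τ ∈ T K \ Bad K t, 0 < Q K t τ)
    (hosc : ∀ K (t t' : ℝ), |t| ≤ l₀ → |t'| ≤ l₀ → ∀ τ ∈ T K \ Bad K t, ∀ τ' ∈ T K \ Bad K t',
      (Real.log (Q K t τ) - Real.log (P K t τ)) - (Real.log (Q K t' τ') - Real.log (P K t' τ')) ≤ 2 * (vol * δ K)) :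
    NE7.Core l₀ vol T Bad P Q δ := by
  intro K
  obtain ⟨c, hc⟩ := exists_center_of_pairwise_le
    (s := {x : ℝ | ∃ t : ℝ, ∃ τ : ι, |t| ≤ l₀ ∧ τ ∈ T K \ Bad K t ∧ x = Real.log (Q K t τ) - Real.log (P K t τ)})
    (η := vol * δ K) (by
      rintro x ⟨t, τ, ht, hτ, rfl⟩ y ⟨t', τ', ht', hτ', rfl⟩
      exact sub_le_iff_le_add'.mp (hosc K t t' ht ht' τ hτ τ' hτ'))
  exact ⟨c, fun t ht τ hτ => NE7.sandwich_of_abs_log_sub_le (hP K t ht τ hτ) (hQ K t ht τ hτ)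
    (hc (Real.log (Q K t τ) - Real.log (P K t τ)) ⟨t, τ, ht, hτ, rfl⟩)⟩

/-- **`Core` ⟺ PAIRWISE OSCILLATION `≤ 2·vol·δ_K`** on positive cores: NE7 proper with no matching constant to name. [folklore] -/
theorem core_iff_logRatio_osc_le (hP : ∀ K t, |t| ≤ l₀ → ∀ τ ∈ T K \ Bad K t, 0 < P K t τ)
    (hQ : ∀ K t, |t| ≤ l₀ → ∀ τ ∈ T K \ Bad K t, 0 < Q K t τ) :
    NE7.Core l₀ vol T Bad P Q δ ↔ ∀ K (t t' : ℝ), |t| ≤ l₀ → |t'| ≤ l₀ → ∀ τ ∈ T K \ Bad K t, ∀ τ' ∈ T K \ Bad K t',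
      (Real.log (Q K t τ) - Real.log (P K t τ)) - (Real.log (Q K t' τ') - Real.log (P K t' τ')) ≤ 2 * (vol * δ K) :=
  ⟨fun h K t t' ht ht' τ hτ τ' hτ' => logRatio_sub_logRatio_le_of_core h K ht ht' hτ hτ' (hP K t ht τ hτ) (hP K t' ht' τ' hτ'),
    core_of_logRatio_osc_le hP hQ⟩

/-- **N19's ∃δ-EDGE, INTRINSICALLY** (`0 < vol`): `∃ δ, Core … δ ∧ Summable δ` ⟺ «the pairwise oscillation of the log-ratio of the two runs'
cores over the good points of level `K` is bounded by a SUMMABLE `D_K`».  Both existentials over functions of Bałaban's objects (the constants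
`c_K`, the remainder `δ`) are eliminated; what NE7 proper asks is that `log (B − shB) − log (A − shA)` depend on `(t, class)` only up to a
summable amount. [folklore] -/
theorem coreEdge_iff_summable_osc (hvol : 0 < vol) (hP : ∀ K t, |t| ≤ l₀ → ∀ τ ∈ T K \ Bad K t, 0 < P K t τ)
    (hQ : ∀ K t, |t| ≤ l₀ → ∀ τ ∈ T K \ Bad K t, 0 < Q K t τ) :
    (∃ δ : ℕ → ℝ, NE7.Core l₀ vol T Bad P Q δ ∧ Summable δ) ↔
      ∃ D : ℕ → ℝ, Summable D ∧ ∀ K (t t' : ℝ), |t| ≤ l₀ → |t'| ≤ l₀ → ∀ τ ∈ T K \ Bad K t, ∀ τ' ∈ T K \ Bad K t',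
        (Real.log (Q K t τ) - Real.log (P K t τ)) - (Real.log (Q K t' τ') - Real.log (P K t' τ')) ≤ D K := by
  constructor
  · rintro ⟨δ, hcore, hδ⟩
    exact ⟨fun K => 2 * (vol * δ K), (hδ.mul_left vol).mul_left 2, (core_iff_logRatio_osc_le hP hQ).mp hcore⟩
  · rintro ⟨D, hD, hosc⟩
    have e : ∀ K, 2 * (vol * (D K / (2 * vol))) = D K := fun K => by field_simp
    refine ⟨fun K => D K / (2 * vol), core_of_logRatio_osc_le hP hQ fun K t t' ht ht' τ hτ τ' hτ' => ?_, hD.div_const _⟩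
    rw [e K]
    exact hosc K t t' ht ht' τ hτ τ' hτ'

/-- THE EDGE COMPOSES: an intermediate core family `M` with `∃ δ₁, Core P M δ₁ ∧ Summable δ₁` and `∃ δ₂, Core M Q δ₂ ∧ Summable δ₂` gives N19's
edge `∃ δ, Core P Q δ ∧ Summable δ` (`δ = δ₁ + δ₂`, chain rule). [folklore] -/
theorem coreEdge_trans {M : ℕ → ℝ → ι → ℝ} (h₁ : ∃ δ : ℕ → ℝ, NE7.Core l₀ vol T Bad P M δ ∧ Summable δ)
    (h₂ : ∃ δ : ℕ → ℝ, NE7.Core l₀ vol T Bad M Q δ ∧ Summable δ) :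
    ∃ δ : ℕ → ℝ, NE7.Core l₀ vol T Bad P Q δ ∧ Summable δ := by
  obtain ⟨δ₁, hc₁, hs₁⟩ := h₁
  obtain ⟨δ₂, hc₂, hs₂⟩ := h₂
  exact ⟨fun K => δ₁ K + δ₂ K, core_trans hc₁ hc₂, hs₁.add hs₂⟩

end Oscillation

/-! ## §3 At the spine carriers: `S_N19` from an oscillation reading ∕ from a two-leg reading [bookkeeping] -/

section Carriers

variable {N : ℕ} [NeZero N]

/-- **`S_N19` FROM AN OSCILLATION READING** (under the `deltaOfRecord` pin of record): if the carriers of record and K4's inputs hand, for every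
bundle, `0 < S.vol`, POSITIVE shell-free cores `A − shA`, `B − shB` on the good classes, and a SUMMABLE bound `D_K` on the pairwise oscillation of
`log (B − shB) − log (A − shA)` over the good points of level `K`, then `YMDAG.UVSplit.S_N19 SRec Inputs` (`s_N19_of_coreEdge` BY NAME ∘ §2);
`SRec`, `Inputs` PARAMETERS; the reading is NE7 proper in its intrinsic currency — NOT PRINTED, NOT produced here. [folklore] -/
theorem s_N19_of_oscillationReading (SRec : SpineRecordPred N) (Inputs : InputsPred N)
    (hpin : ∀ (F : T4Continuum.T4Family) (D : YMDAG.UVSplit.Datum F N) (g₀ : ℕ → ℝ) (os : List (T4Continuum.ULoop F))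
      (S : SpineCarriers), SRec F D g₀ os S → letI := S.dec
      S.δ = deltaOfRecord S.l₀ S.vol S.T S.Bad (fun K t τ => S.A K t τ - S.shA K t τ) (fun K t τ => S.B K t τ - S.shB K t τ))
    (hread : ∀ (F : T4Continuum.T4Family) (D : YMDAG.UVSplit.Datum F N) (g₀ : ℕ → ℝ) (os : List (T4Continuum.ULoop F))
      (S : SpineCarriers), SRec F D g₀ os S → Inputs F D g₀ os → letI := S.dec
      0 < S.vol ∧
      (∀ K t, |t| ≤ S.l₀ → ∀ τ ∈ S.T K \ S.Bad K t, 0 < S.A K t τ - S.shA K t τ ∧ 0 < S.B K t τ - S.shB K t τ) ∧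
      ∃ D : ℕ → ℝ, Summable D ∧ ∀ K (t t' : ℝ), |t| ≤ S.l₀ → |t'| ≤ S.l₀ →
        ∀ τ ∈ S.T K \ S.Bad K t, ∀ τ' ∈ S.T K \ S.Bad K t',
          (Real.log (S.B K t τ - S.shB K t τ) - Real.log (S.A K t τ - S.shA K t τ)) -
            (Real.log (S.B K t' τ' - S.shB K t' τ') - Real.log (S.A K t' τ' - S.shA K t' τ')) ≤ D K) :
    S_N19 SRec Inputs := by
  refine s_N19_of_coreEdge SRec Inputs hpin fun F D g₀ os S hS hI => ?_
  letI := S.dec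
  obtain ⟨hvol, hpos, hD⟩ := hread F D g₀ os S hS hI
  exact (coreEdge_iff_summable_osc hvol (fun K t ht τ hτ => (hpos K t ht τ hτ).1)
    (fun K t ht τ hτ => (hpos K t ht τ hτ).2)).mpr hD

/-- **`S_N19` FROM A TWO-LEG READING** (under the pin of record): if the carriers of record and K4's inputs hand, for every bundle, an INTERMEDIATE
core family `M` on the carriers' class type with two summable `Core` legs `A − shA → M → B − shB` (e.g. run A → re-blocked run A⁺, then A⁺ → B
by the H1L path face `NE7.core_of_pathLeaf`), then `S_N19 SRec Inputs` (`s_N19_of_coreEdge` ∘ `coreEdge_trans`); neither leg is produced here. [folklore] -/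
theorem s_N19_of_twoLegReading (SRec : SpineRecordPred N) (Inputs : InputsPred N)
    (hpin : ∀ (F : T4Continuum.T4Family) (D : YMDAG.UVSplit.Datum F N) (g₀ : ℕ → ℝ) (os : List (T4Continuum.ULoop F))
      (S : SpineCarriers), SRec F D g₀ os S → letI := S.dec
      S.δ = deltaOfRecord S.l₀ S.vol S.T S.Bad (fun K t τ => S.A K t τ - S.shA K t τ) (fun K t τ => S.B K t τ - S.shB K t τ))
    (hlegs : ∀ (F : T4Continuum.T4Family) (D : YMDAG.UVSplit.Datum F N) (g₀ : ℕ → ℝ) (os : List (T4Continuum.ULoop F))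
      (S : SpineCarriers), SRec F D g₀ os S → Inputs F D g₀ os → letI := S.dec
      ∃ M : ℕ → ℝ → S.ι → ℝ,
        (∃ δ₁ : ℕ → ℝ, NE7.Core S.l₀ S.vol S.T S.Bad (fun K t τ => S.A K t τ - S.shA K t τ) M δ₁ ∧ Summable δ₁) ∧
        (∃ δ₂ : ℕ → ℝ, NE7.Core S.l₀ S.vol S.T S.Bad M (fun K t τ => S.B K t τ - S.shB K t τ) δ₂ ∧ Summable δ₂)) :
    S_N19 SRec Inputs := by
  refine s_N19_of_coreEdge SRec Inputs hpin fun F D g₀ os S hS hI => ?_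
  letI := S.dec
  obtain ⟨M, h₁, h₂⟩ := hlegs F D g₀ os S hS hI
  exact coreEdge_trans h₁ h₂

end Carriers

/-! ## §4 The Z-level twin: `Spine.NE7.Target` ⟺ uniformly summable increments of the generating functions [folklore] -/

section ZLevel

variable {vol l₀ : ℝ} {δ : ℕ → ℝ} {Z : ℕ → ℝ → ℝ}

/-- **MATCHING MODULO CONSTANTS FROM THE GENERATING FUNCTIONS**: a uniform increment bound `|genFun Z (K+1) t − genFun Z K t| ≤ vol·δ_K` on
`|t| ≤ l₀` gives `MatchingModConstants vol l₀ δ Z` with the CANONICAL constants `c_K := log Z_{K+1}(0) − log Z_K(0)` (converse, with a factor `2`: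
`T4CauchySum.abs_genFun_succ_sub_le`). [folklore] -/
theorem matchingModConstants_of_genFun_increments
    (h : ∀ (K : ℕ) (t : ℝ), |t| ≤ l₀ → |genFun Z (K + 1) t - genFun Z K t| ≤ vol * δ K) :
    MatchingModConstants vol l₀ δ Z := fun K =>
  ⟨Real.log (Z (K + 1) 0) - Real.log (Z K 0), fun t ht => by
    have e : Real.log (Z (K + 1) t) - Real.log (Z K t) - (Real.log (Z (K + 1) 0) - Real.log (Z K 0)) =
        genFun Z (K + 1) t - genFun Z K t := by simp only [genFun]; ring
    exact e ▸ h K t ht⟩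

/-- **N19's DECL TARGET, INTRINSICALLY** (`0 ≤ l₀`): `∃ vol δ, Spine.NE7.Target vol l₀ δ Z` ⟺ the generating functions `genFun Z K` have
UNIFORMLY ABSOLUTELY SUMMABLE INCREMENTS on the closed `l₀`-ball — a statement about `Z` alone (bounded variation in `K`), with no constants and
no volume factor to name. [folklore] -/
theorem exists_target_iff_summable_genFun_increments (hl₀ : 0 ≤ l₀) :
    (∃ (vol : ℝ) (δ : ℕ → ℝ), NE7.Target vol l₀ δ Z) ↔
      ∃ D : ℕ → ℝ, Summable D ∧ ∀ (K : ℕ) (t : ℝ), |t| ≤ l₀ → |genFun Z (K + 1) t - genFun Z K t| ≤ D K := by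
  constructor
  · rintro ⟨vol, δ, hM, hδ⟩
    exact ⟨fun K => 2 * (vol * δ K), (hδ.mul_left vol).mul_left 2,
      fun K t ht => T4CauchySum.abs_genFun_succ_sub_le hM hl₀ K ht⟩
  · rintro ⟨D, hD, h⟩
    exact ⟨1, D, matchingModConstants_of_genFun_increments (fun K t ht => by rw [one_mul]; exact h K t ht), hD⟩

/-- **KERNEL GUARD — CONVERGENT GENERATING FUNCTIONS WITH STEP-WISE MATCHING AND VANISHING REMAINDER, YET NO TARGET.**  A positive `Z` with
`genFun Z K t → 0` for EVERY `t` (node U0's input holds along the full sequence) and `MatchingModConstants 1 1 δ₀ Z` with `δ₀ → 0` (every step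
matches modulo constants, ever better), but `¬ ∃ vol δ, Spine.NE7.Target vol 1 δ Z` (`T4ApexVariance.exists_tendsto_not_summable_increments` BY
NAME, lifted to `Z_K(t) = e^{t·a_K}`): N19's `Target` (Σ_K δ_K < ∞) is a SUFFICIENT road to U0's input, strictly stronger than it. [folklore] -/
theorem exists_tendsto_genFun_not_target :
    ∃ Z : ℕ → ℝ → ℝ, (∀ K t, 0 < Z K t) ∧ (∀ t : ℝ, Tendsto (fun K => genFun Z K t) atTop (𝓝 0)) ∧
      (∃ δ₀ : ℕ → ℝ, Tendsto δ₀ atTop (𝓝 0) ∧ MatchingModConstants 1 1 δ₀ Z) ∧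
      ¬ ∃ (vol : ℝ) (δ : ℕ → ℝ), NE7.Target vol 1 δ Z := by
  obtain ⟨a, ha, hna⟩ := T4ApexVariance.exists_tendsto_not_summable_increments
  have hgen : ∀ K t, genFun (fun K t => Real.exp (t * a K)) K t = t * a K := fun K t => by
    simp only [genFun, Real.log_exp, zero_mul, sub_zero]
  refine ⟨fun K t => Real.exp (t * a K), fun K t => Real.exp_pos _, fun t => ?_, ?_, ?_⟩
  · simp only [hgen]
    simpa using ha.const_mul t
  · refine ⟨fun K => |a (K + 1) - a K|, ?_, fun K => ⟨0, fun t ht => ?_⟩⟩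
    · have h1 : Tendsto (fun K => a (K + 1) - a K) atTop (𝓝 (0 - 0)) := (ha.comp (tendsto_add_atTop_nat 1)).sub ha
      rw [sub_zero] at h1
      simpa using h1.abs
    · simp only [Real.log_exp, sub_zero, one_mul, ← mul_sub, abs_mul]
      exact mul_le_of_le_one_left (abs_nonneg _) ht
  · rintro ⟨vol, δ, hM, hδ⟩
    refine hna (Summable.of_nonneg_of_le (fun K => abs_nonneg _) (fun K => ?_) ((hδ.mul_left vol).mul_left 2))
    have h1 := T4CauchySum.abs_genFun_succ_sub_le hM zero_le_one K (t := 1) (by simp)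
    simpa only [hgen, one_mul] using h1

end ZLevel

end Summit.QuantumFields.YangMills.BalabanUVNodes.N19CoreMetric

end
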